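/-
Copyright (c) 2026 the pub-hodgecm-mathlib formalisation cell (harness21).  Prover seat hodgecm-mathlib-K2Liu-p10 (g3), Track B «K2-LIT»,
#184♮ = hLiu418 = `stmt-HodgeConjecture-24832`; LEAD F0P6-plan (g13) RULING «M-157j» (1): G5-a sub-organ (α) (the middle cell of the
constant term), file α3-2 — THE MIDDLE CELL OF THE CONSTANT TERM FOR `n = 2` IS A `GL₂` BOREL EISENSTEIN SUM `Σ_{p ∈ ℙ¹(L)} F(Λ(γ p)^ h)`.
THEOREMS ONLY (no `def`, no `instance`, no named-fact hypothesis, no `sorry`).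
-/
import Summits.HodgeConjecture.HodgeConjecture.Theorems.K2LiuConstantTermMiddleCellOrbits   -- α2d-2: REST = ⨆_p O(γ p), stabilisers
import Summits.HodgeConjecture.HodgeConjecture.Theorems.K2LiuConstantTermMiddleCellPrelims  -- α3-1: orbit `L¹` bounds, conjugations, Fubini, regrouping
import Summits.HodgeConjecture.HodgeConjecture.Theorems.K2LiuCoveringWeightTransport        -- α1: transport along `u ↦ Λĝ u Λĝ⁻¹`
import HarnessLib

/-!
# Crux `HLiu418`, ROAD Φ, (α) file α3-2: THE MIDDLE CELL OF THE CONSTANT TERM OF `E^Δ(h; f)` FOR `n = 2` —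
# `∫ β(u) • Σ_{q ∈ REST} f(γ_q u h) dνN(u) = Σ_{p ∈ ℙ¹(L)} F(Λ(γ p)^ · h)`, `F(x) = ∫ β₁(u) • f(w₀ u x) dνN(u)` ("`∫_{N_χ(L⁺)∖N_Δ(𝔸)} f(w₀ u x) du`")

Cell `hodgecm-mathlib`, crux item hLiu418 = `stmt-HodgeConjecture-24832` (helper lane, count-neutral).  ★ O41.4 `K2LiuConstantTermDelta.constTerm_three_cells`
splits the constant term of the Siegel Eisenstein series along `N_Δ` into the identity cell, the big cell and the MIDDLE CELL
`MID(h) = ∫ β(u) • Σ_{q ∈ REST} f(γ_q u h) dνN(u)` (REST = the cosets of `P_Δ(L⁺)∖H(L⁺)` off `{[1]}` and off `[w_Δ N_Δ(L⁺)]`, an `N_Δ(L⁺)`-covering weight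
`β` making "`∫_{N_Δ(L⁺)∖N_Δ(𝔸)}`" quotient-free).  For `n = 2` (α2b: one middle representative `w₀`; α2d: REST `= ⨆_{p ∈ ℙ¹(L)} O(γ p)`,
`O(g) = {[w₀ Λĝ ν]}`, `Stab([w₀Λĝ]) = Λĝ⁻¹ Stab([w₀]) Λĝ`) this file computes `MID` as the `GL₂` BOREL EISENSTEIN SUM of the inner section `F`:
* (α3-1 `K2LiuConstantTermMiddleCellPrelims`: `lintegral_orbit_ne_top`, `exists_conj_mulEquiv`, `integral_wt_smul_tsum_subtype_eq_tsum`,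
  `summable_integral_wt_smul`, `hasSum_tsum_subtype_of_eq_iUnion` — the general-`n` devices;)
* **`tsum_orbit_reflStd_levi_eq`** — for `g ∈ GL₂(L)`: `Σ_{x ∈ O(g)} ∫ β • f(γ_x u h) = F(Λĝ · h)` — α2a at `Γ' = Stab([w₀Λĝ]) = Γ₀.comap(conj Λĝ)` with the
  pulled-back weight `β₁ ∘ conj Λĝ` (α1 `isCoveringWeight_comp`), the identity `f(w₀ Λĝ u h) = f(w₀ (ΛĝuΛĝ⁻¹) (Λĝ h))`, α1
  `integral_wt_smul_comp_mulEquiv` along the `νN`-preserving automorphism `u ↦ Λĝ u Λĝ⁻¹` (measure preservation BY VALUE, discharged for Haar `νN` in (T2)),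
  and the left-`Stab([w₀])`-invariance of `u ↦ f(w₀ u x)` (★ `apply_translate_subgroup_mul`);
* **`hasSum_middle_cell`** — `HasSum (p ↦ F(Λ(γ p)^ · h)) (MID(h))` for any row section `γ : ℙ(L²) → GL₂(L)`: REST `= ⨆_p O(γ p)` (α2d-2
  `rest_eq_iUnion_orbit`, `pairwise_disjoint_orbit`), the regrouping and the orbit values above; **`middle_cell_eq_tsum`** (`MID = Σ'` and `Summable`).
The datum `F`, the stabiliser `Γ₀ = Stab([w₀])` (membership law, = α2d-2 `stabilizer_reflStd_iff`'s `{X₁₁ = 0}`), its weight `β₁`, `Λ ∕ hΛ`, `g₀ ∕ hg₀`, the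
big-cell representatives `wq` and the conjugation invariance of `νN` are BY VALUE — the shape ★ (γ) `K2LiuSiegelEisensteinRankZeroTermPackage.exists_middle_package`
instantiates (`X := H(𝔸)`, `g j x := Λ(γ p)^ · x`-type coordinates) once (β) puts `F|_{GL₂}` in Godement form.
Sources: [MoeglinWaldspurger1995, II.1.7 (constant terms along `w⁻¹Pw ∩ N`)]; [KudlaRallis1994, §2 (2.10)–(2.12)]; [GelbartPiatetskishapiroRallis1987, Part A §2];
[Garrett2018, §3.10]; [CogdellAnalyticTheory2004, §2.3].
HONEST LABEL.  Helper lemmas, count-neutral; `HC_CM` is proved only modulo the 7 printed citations (2 remaining named inputs: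
hLiu418 = `stmt-HodgeConjecture-24832`, h413 = `stmt-HodgeConjecture-24833`) until rung 0 closes.
-/

set_option autoImplicit false
set_option linter.dupNamespace false -- the mandated namespace repeats `HodgeConjecture.HodgeConjecture`

noncomputable section

open scoped Matrix ENNReal NNReal
open NumberField IsDedekindDomain MeasureTheory MeasureTheory.Measure Filter Set Function
open Literature.NumberTheory.Automorphic Literature.NumberTheory.Automorphic.UnitaryGroup Literature.NumberTheory.GaloisRepresentations
open Literature.NumberTheory.GelbartRogawski1991 Literature.NumberTheory.GelbartRogawski1991.GRConstruction
open Literature.NumberTheory.GelbartRogawski1991.AdaptedBlocks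
open Literature.NumberTheory.K2Lit.SiegelDoubled Literature.MeasureTheory.Group
open UnitaryDualPair

namespace Summit.HodgeConjecture.HodgeConjecture.Cruxes.HLiu418.K2LiuConstantTermMiddleCellGL2

open K2LiuUnipotentCoveringWeight K2LiuConstantTermBigCellUnfold K2LiuSiegelDoubledUnfold K2LiuConstantTermDelta
  K2LiuSiegelEisensteinCoeffCells K2LiuSiegelEisensteinCoeffOrbitSum K2LiuSiegelBruhatMiddleCellDelta K2LiuSiegelEisensteinCoeffNondegenerate
  K2LiuSiegelEisensteinCoeffMiddleOrbits K2LiuSiegelMiddleOrbitUnfold K2LiuCoveringWeightTransport K2LiuSiegelRationalLeviDecomposition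
  K2LiuSiegelMiddleCellLeviCriterion K2LiuConstantTermMiddleCellOrbits K2LiuConstantTermMiddleCellPrelims

variable {L : Type} [Field L] [NumberField L] [IsCMField L]

/-! ## `n = 2`: the value of one middle orbit, and the middle cell as a `GL₂` Borel Eisenstein sum -/

section Two

variable {N M : ℕ} {e : Fin N × Fin M ≃ Fin 2}
  {dV : Fin N → L} {hdV : ∀ i, IsCMField.complexConj L (dV i) = dV i}
  {dW : Fin M → L} {hdW : ∀ i, IsCMField.complexConj L (dW i) = dW i}
variable [MeasurableSpace (unipDelta L e dV hdV dW hdW)] [BorelSpace (unipDelta L e dV hdV dW hdW)]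

variable {g₀ : UnitaryGroup.rationalPair (Fp L) L (IsCMField.complexConj L) N M (Matrix.diagonal dV) (Matrix.diagonal dW)}
  (hg₀ : ((g₀ : GL (Fin N × Fin M) L) : Matrix (Fin N × Fin M) (Fin N × Fin M) L) = Matrix.diagonal (fun k => 1 - 2 * (![0, 1] : Fin 2 → L) (e k)))
  (Λ : GL (Fin 2) (AdeleRing (𝓞 L) L) →* HA L e dV hdV dW hdW)
  (hΛ : ∀ g : GL (Fin 2) (AdeleRing (𝓞 L) L), blk L e dV hdV dW hdW (Λ g) =
    cayR (AdeleRing (𝓞 L) L) (Fin 2) * Matrix.fromBlocks (g : Matrix (Fin 2) (Fin 2) (AdeleRing (𝓞 L) L)) 0 0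
      (((gramR L e dV hdV dW hdW).map ((algebraMap L (AdeleRing (𝓞 L) L)).comp (algebraMap (Fp L) L)))⁻¹ *
        (((g⁻¹ : GL (Fin 2) (AdeleRing (𝓞 L) L)) : Matrix (Fin 2) (Fin 2) (AdeleRing (𝓞 L) L)).map
          (conjAdele (Fp L) L (IsCMField.complexConj L)))ᵀ *
        (gramR L e dV hdV dW hdW).map ((algebraMap L (AdeleRing (𝓞 L) L)).comp (algebraMap (Fp L) L))) *
      cayRinv (AdeleRing (𝓞 L) L) (Fin 2))
  (Γ₀ : Subgroup (unipDelta L e dV hdV dW hdW))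
  (hΓ₀ : ∀ u : unipDelta L e dV hdV dW hdW, u ∈ Γ₀ ↔ (u : HA L e dV hdV dW hdW) ∈ ratH L e dV hdV dW hdW ∧
    IsSiegelDelta L e dV hdV dW hdW (iotaGG L e dV hdV dW hdW (1, UnitaryGroup.rationalPairToAdelic (Fp L) L (IsCMField.complexConj L) N M (Matrix.diagonal dV) (Matrix.diagonal dW) g₀) * (u : HA L e dV hdV dW hdW) * (iotaGG L e dV hdV dW hdW (1, UnitaryGroup.rationalPairToAdelic (Fp L) L (IsCMField.complexConj L) N M (Matrix.diagonal dV) (Matrix.diagonal dW) g₀))⁻¹))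

include hΛ hΓ₀ in
/-- **THE VALUE OF ONE MIDDLE ORBIT.**  For `g ∈ GL₂(L)`, with `γ₀ = w₀ Λĝ`, `O(g) = {[γ₀ ν] : ν ∈ N_Δ(L⁺)}`, `Γ₀ = Stab([w₀])` and `β₁` a `Γ₀`-weight,
`F(x) = ∫ β₁(u) • f(w₀ u x) dνN(u)`, and `u ↦ Λĝ u Λĝ⁻¹` preserving `νN`:
  `Σ_{x ∈ O(g)} ∫ β(u) • f(γ_x u h) dνN(u) = F(Λĝ · h)`.
(α2a at `Γ' = Stab([γ₀]) = Γ₀.comap(conj Λĝ)` (α2d-2 `stabilizer_levi_iff`) with the weight `β₁ ∘ conj Λĝ`; `f(w₀ Λĝ u h) = f(w₀ (ΛĝuΛĝ⁻¹) (Λĝ h))`; α1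
`integral_wt_smul_comp_mulEquiv`; ★ `apply_translate_subgroup_mul` for the left-`Γ₀`-invariance; §1 for the `L¹` bound.)
[cite: MoeglinWaldspurger1995, II.1.7] [cite: KudlaRallis1994, §2] [cite: CogdellAnalyticTheory2004, §2.3] -/
theorem tsum_orbit_reflStd_levi_eq (hdV0 : ∀ i, dV i ≠ 0) (hdW0 : ∀ i, dW i ≠ 0) (νN : Measure (unipDelta L e dV hdV dW hdW)) [νN.IsMulLeftInvariant]
    {β : unipDelta L e dV hdV dW hdW → ℝ≥0∞} (hβ : IsCoveringWeight (unipDeltaRat L e dV hdV dW hdW) β)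
    {χ : HeckeCharacter L} {s : ℂ} {f : HA L e dV hdV dW hdW → ℂ} (hf : IsSiegelDeltaSection L e dV hdV dW hdW χ s f) (hfc : Continuous f)
    (h : HA L e dV hdV dW hdW) {β₁ : unipDelta L e dV hdV dW hdW → ℝ≥0∞} (hβ₁ : IsCoveringWeight Γ₀ β₁) (g : GL (Fin 2) L)
    (hconj : MeasurePreserving (fun u : unipDelta L e dV hdV dW hdW =>
      (⟨Λ (Matrix.GeneralLinearGroup.map (algebraMap L (AdeleRing (𝓞 L) L)) g) * (u : HA L e dV hdV dW hdW) *
          (Λ (Matrix.GeneralLinearGroup.map (algebraMap L (AdeleRing (𝓞 L) L)) g))⁻¹,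
        conj_levi_mem_unipDelta L e dV hdV dW hdW Λ hΛ _ u.2⟩ : unipDelta L e dV hdV dW hdW)) νN νN)
    (F : HA L e dV hdV dW hdW → ℂ)
    (hF : ∀ x, F x = ∫ u, (β₁ u).toReal •
      f (iotaGG L e dV hdV dW hdW (1, UnitaryGroup.rationalPairToAdelic (Fp L) L (IsCMField.complexConj L) N M (Matrix.diagonal dV) (Matrix.diagonal dW) g₀) *
        ((u : HA L e dV hdV dW hdW) * x)) ∂νN)
    (hγ₀ : iotaGG L e dV hdV dW hdW (1, UnitaryGroup.rationalPairToAdelic (Fp L) L (IsCMField.complexConj L) N M (Matrix.diagonal dV) (Matrix.diagonal dW) g₀) *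
      Λ (Matrix.GeneralLinearGroup.map (algebraMap L (AdeleRing (𝓞 L) L)) g) ∈ ratH L e dV hdV dW hdW)
    (hO : ∫⁻ u, (∑' q : ↥(Set.range (fun ν : unipDeltaRat L e dV hdV dW hdW =>
        (Quotient.mk (MulAction.orbitRel (siegelDeltaRat L e dV hdV dW hdW) (ratH L e dV hdV dW hdW))
          ((⟨_, hγ₀⟩ : ratH L e dV hdV dW hdW) * ⟨((ν : unipDelta L e dV hdV dW hdW) : HA L e dV hdV dW hdW), coe_mem_ratH ν⟩)))),
        ‖f (((Quotient.out q.1 : ratH L e dV hdV dW hdW) : HA L e dV hdV dW hdW) * ((u : HA L e dV hdV dW hdW) * h))‖ₑ) * β u ∂νN ≠ ∞) :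
    ∑' q : ↥(Set.range (fun ν : unipDeltaRat L e dV hdV dW hdW =>
        (Quotient.mk (MulAction.orbitRel (siegelDeltaRat L e dV hdV dW hdW) (ratH L e dV hdV dW hdW))
          ((⟨_, hγ₀⟩ : ratH L e dV hdV dW hdW) * ⟨((ν : unipDelta L e dV hdV dW hdW) : HA L e dV hdV dW hdW), coe_mem_ratH ν⟩)))),
      ∫ u, (β u).toReal • f (((Quotient.out q.1 : ratH L e dV hdV dW hdW) : HA L e dV hdV dW hdW) * ((u : HA L e dV hdV dW hdW) * h)) ∂νN =
      F (Λ (Matrix.GeneralLinearGroup.map (algebraMap L (AdeleRing (𝓞 L) L)) g) * h) := by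
  haveI : Countable (unipDeltaRat L e dV hdV dW hdW) := countable_unipDeltaRat L e dV hdV dW hdW
  have hw₀r : iotaGG L e dV hdV dW hdW (1, UnitaryGroup.rationalPairToAdelic (Fp L) L (IsCMField.complexConj L) N M (Matrix.diagonal dV) (Matrix.diagonal dW) g₀) ∈ ratH L e dV hdV dW hdW :=
    iotaGG_one_mem_ratH L e dV hdV dW hdW g₀
  -- the conjugation automorphism `φ = conj(Λĝ)` of `N_Δ(𝔸)` (abstractly, through its values)
  obtain ⟨φ, hφ, hφs⟩ := exists_conj_mulEquiv (Λ (Matrix.GeneralLinearGroup.map (algebraMap L (AdeleRing (𝓞 L) L)) g))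
    (fun u hu => conj_levi_mem_unipDelta L e dV hdV dW hdW Λ hΛ _ hu) (fun u hu => inv_conj_levi_mem_unipDelta L e dV hdV dW hdW Λ hΛ _ hu)
  have hφfun : (φ : unipDelta L e dV hdV dW hdW → unipDelta L e dV hdV dW hdW) = fun u : unipDelta L e dV hdV dW hdW =>
      (⟨Λ (Matrix.GeneralLinearGroup.map (algebraMap L (AdeleRing (𝓞 L) L)) g) * (u : HA L e dV hdV dW hdW) *
          (Λ (Matrix.GeneralLinearGroup.map (algebraMap L (AdeleRing (𝓞 L) L)) g))⁻¹,
        conj_levi_mem_unipDelta L e dV hdV dW hdW Λ hΛ _ u.2⟩ : unipDelta L e dV hdV dW hdW) := funext fun u => Subtype.ext (hφ u)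
  have hφsfun : (φ.symm : unipDelta L e dV hdV dW hdW → unipDelta L e dV hdV dW hdW) = fun u : unipDelta L e dV hdV dW hdW =>
      (⟨(Λ (Matrix.GeneralLinearGroup.map (algebraMap L (AdeleRing (𝓞 L) L)) g))⁻¹ * (u : HA L e dV hdV dW hdW) *
          Λ (Matrix.GeneralLinearGroup.map (algebraMap L (AdeleRing (𝓞 L) L)) g),
        inv_conj_levi_mem_unipDelta L e dV hdV dW hdW Λ hΛ _ u.2⟩ : unipDelta L e dV hdV dW hdW) := funext fun u => Subtype.ext (hφs u)
  have hφm : Measurable (φ : unipDelta L e dV hdV dW hdW → unipDelta L e dV hdV dW hdW) := by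
    rw [hφfun]
    exact (Continuous.subtype_mk ((continuous_const.mul continuous_subtype_val).mul continuous_const) _).measurable
  have hφsm : Measurable (φ.symm : unipDelta L e dV hdV dW hdW → unipDelta L e dV hdV dW hdW) := by
    rw [hφsfun]
    exact (Continuous.subtype_mk ((continuous_const.mul continuous_subtype_val).mul continuous_const) _).measurable
  have hmp : MeasurePreserving φ νN νN := by
    rw [hφfun]
    exact hconj
  -- `Γ' = Stab([w₀ Λĝ]) = Γ₀.comap φ`: membership law and the pulled-back weight `β₁ ∘ φ`
  have hΓ'law : ∀ u : unipDelta L e dV hdV dW hdW, u ∈ Γ₀.comap φ.toMonoidHom ↔ (u : HA L e dV hdV dW hdW) ∈ ratH L e dV hdV dW hdW ∧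
      IsSiegelDelta L e dV hdV dW hdW ((((⟨_, hγ₀⟩ : ratH L e dV hdV dW hdW)) : HA L e dV hdV dW hdW) * (u : HA L e dV hdV dW hdW) *
        ((((⟨_, hγ₀⟩ : ratH L e dV hdV dW hdW)) : HA L e dV hdV dW hdW))⁻¹) := by
    intro u
    rw [Subgroup.mem_comap, MulEquiv.coe_toMonoidHom, hΓ₀ (φ u), hφ u, Subtype.coe_mk]
    exact (stabilizer_levi_iff Λ hΛ hdV0 hdW0 g (u : HA L e dV hdV dW hdW)).symm
  have hβ₁' : IsCoveringWeight (Γ₀.comap φ.toMonoidHom) (fun u => β₁ (φ u)) := isCoveringWeight_comp φ hφm Γ₀ hβ₁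
  -- α2a: the orbit sum is one weighted integral against `β₁ ∘ φ`
  rw [tsum_orbit_eq_integral_wt_smul_zero νN hβ hf hfc ⟨_, hγ₀⟩ h (Γ₀.comap φ.toMonoidHom) hΓ'law hβ₁' hO]
  -- `w₀` as an element `γ₁` of `H(L⁺)` (kept abstract: no unfolding of `ι`)
  obtain ⟨γ₁, hγ₁⟩ : ∃ γ₁ : ratH L e dV hdV dW hdW, (γ₁ : HA L e dV hdV dW hdW) = iotaGG L e dV hdV dW hdW (1, UnitaryGroup.rationalPairToAdelic (Fp L) L (IsCMField.complexConj L) N M (Matrix.diagonal dV) (Matrix.diagonal dW) g₀) :=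
    ⟨⟨_, hw₀r⟩, Subtype.coe_mk _ _⟩
  -- `f(w₀ Λĝ u h) = Φ(φ u)`, `Φ(u) = f(w₀ u (Λĝ h))`
  have hΦeq : ∀ u : unipDelta L e dV hdV dW hdW, f ((((⟨_, hγ₀⟩ : ratH L e dV hdV dW hdW)) : HA L e dV hdV dW hdW) * (u : HA L e dV hdV dW hdW) * h) =
      f ((γ₁ : HA L e dV hdV dW hdW) * ((φ u : unipDelta L e dV hdV dW hdW) : HA L e dV hdV dW hdW) * (Λ (Matrix.GeneralLinearGroup.map (algebraMap L (AdeleRing (𝓞 L) L)) g) * h)) := by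
    intro u
    have harg : (((⟨_, hγ₀⟩ : ratH L e dV hdV dW hdW)) : HA L e dV hdV dW hdW) * (u : HA L e dV hdV dW hdW) * h =
        (γ₁ : HA L e dV hdV dW hdW) * ((φ u : unipDelta L e dV hdV dW hdW) : HA L e dV hdV dW hdW) * (Λ (Matrix.GeneralLinearGroup.map (algebraMap L (AdeleRing (𝓞 L) L)) g) * h) := by
      rw [hφ u, hγ₁, Subtype.coe_mk]
      simp only [mul_assoc, inv_mul_cancel_left]
    rw [harg]
  -- `Γ₀`-bookkeeping: countable, rational, `w₀ Γ₀ w₀⁻¹ ⊆ P_Δ`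
  have hΓ₀le : Γ₀ ≤ unipDeltaRat L e dV hdV dW hdW := fun u hu => (mem_unipDeltaRat_iff L e dV hdV dW hdW u).2 ((hΓ₀ u).1 hu).1
  haveI : Countable Γ₀ := (Subgroup.inclusion_injective hΓ₀le).countable
  have hΓ₀rat : ∀ γ ∈ Γ₀, ((γ : unipDelta L e dV hdV dW hdW) : HA L e dV hdV dW hdW) ∈ ratH L e dV hdV dW hdW := fun γ hγ => ((hΓ₀ γ).1 hγ).1
  have hΓ₀P : ∀ γ ∈ Γ₀, IsSiegelDelta L e dV hdV dW hdW
      ((γ₁ : HA L e dV hdV dW hdW) * ((γ : unipDelta L e dV hdV dW hdW) : HA L e dV hdV dW hdW) * ((γ₁ : HA L e dV hdV dW hdW))⁻¹) := by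
    intro γ hγ
    rw [hγ₁]
    exact ((hΓ₀ γ).1 hγ).2
  -- the transported integrand `Φ`: measurable, left-`Γ₀`-invariant, `L¹` against `β₁`
  have hΦm : StronglyMeasurable (fun u : unipDelta L e dV hdV dW hdW => f ((γ₁ : HA L e dV hdV dW hdW) * (u : HA L e dV hdV dW hdW) * (Λ (Matrix.GeneralLinearGroup.map (algebraMap L (AdeleRing (𝓞 L) L)) g) * h))) :=
    (hfc.comp ((continuous_const.mul continuous_subtype_val).mul continuous_const)).stronglyMeasurable
  have hΦinv : ∀ γ ∈ Γ₀, ∀ u : unipDelta L e dV hdV dW hdW,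
      f ((γ₁ : HA L e dV hdV dW hdW) * (((γ * u : unipDelta L e dV hdV dW hdW)) : HA L e dV hdV dW hdW) * (Λ (Matrix.GeneralLinearGroup.map (algebraMap L (AdeleRing (𝓞 L) L)) g) * h)) =
      f ((γ₁ : HA L e dV hdV dW hdW) * (u : HA L e dV hdV dW hdW) * (Λ (Matrix.GeneralLinearGroup.map (algebraMap L (AdeleRing (𝓞 L) L)) g) * h)) :=
    fun γ hγ u => apply_translate_subgroup_mul hf γ₁ _ Γ₀ hΓ₀rat hΓ₀P hγ u
  have hint : ∫⁻ u, ‖f ((γ₁ : HA L e dV hdV dW hdW) * (u : HA L e dV hdV dW hdW) * (Λ (Matrix.GeneralLinearGroup.map (algebraMap L (AdeleRing (𝓞 L) L)) g) * h))‖ₑ * β₁ u ∂νN ≠ ∞ := by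
    have htr := lintegral_mul_comp_mulEquiv νN φ hφm hφsm hmp Γ₀ hβ₁ hβ₁'
      (F := fun u : unipDelta L e dV hdV dW hdW => ‖f ((γ₁ : HA L e dV hdV dW hdW) * (u : HA L e dV hdV dW hdW) * (Λ (Matrix.GeneralLinearGroup.map (algebraMap L (AdeleRing (𝓞 L) L)) g) * h))‖ₑ)
      (measurable_enorm_apply_mul_coe_mul hfc _ _) (fun γ hγ u => by rw [hΦinv γ hγ u])
    rw [← htr]
    refine ne_of_eq_of_ne (lintegral_congr fun u => ?_)
      (lintegral_orbit_ne_top νN hβ hf hfc ⟨_, hγ₀⟩ h (Γ₀.comap φ.toMonoidHom) hΓ'law hβ₁' hO)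
    rw [hΦeq u]
  -- transport along `φ` and read off `F(Λĝ h)`
  calc ∫ u, (β₁ (φ u)).toReal • f ((((⟨_, hγ₀⟩ : ratH L e dV hdV dW hdW)) : HA L e dV hdV dW hdW) * (u : HA L e dV hdV dW hdW) * h) ∂νN
      = ∫ u, ((fun u => β₁ (φ u)) u).toReal • (fun u : unipDelta L e dV hdV dW hdW => f ((γ₁ : HA L e dV hdV dW hdW) * (u : HA L e dV hdV dW hdW) * (Λ (Matrix.GeneralLinearGroup.map (algebraMap L (AdeleRing (𝓞 L) L)) g) * h))) (φ u) ∂νN := by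
        refine integral_congr_ae (ae_of_all _ fun u => ?_)
        simp only [hΦeq u]
    _ = ∫ u, (β₁ u).toReal • (fun u : unipDelta L e dV hdV dW hdW => f ((γ₁ : HA L e dV hdV dW hdW) * (u : HA L e dV hdV dW hdW) * (Λ (Matrix.GeneralLinearGroup.map (algebraMap L (AdeleRing (𝓞 L) L)) g) * h))) u ∂νN :=
        integral_wt_smul_comp_mulEquiv νN φ hφm hφsm hmp Γ₀ hβ₁ hβ₁' hΦm hΦinv hint
    _ = F (Λ (Matrix.GeneralLinearGroup.map (algebraMap L (AdeleRing (𝓞 L) L)) g) * h) := by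
        rw [hF]
        simp only [hγ₁, mul_assoc]

variable (wq : unipDeltaRat L e dV hdV dW hdW → ratH L e dV hdV dW hdW)
  (hwq : ∀ ν, ((wq ν : ratH L e dV hdV dW hdW) : HA L e dV hdV dW hdW) =
    weylDelta L e dV hdV dW hdW * ((ν : unipDelta L e dV hdV dW hdW) : HA L e dV hdV dW hdW))

include hwq hg₀ hΛ hΓ₀ in
/-- **THE MIDDLE CELL OF THE CONSTANT TERM IS A `GL₂` BOREL EISENSTEIN SUM.**  `n = 2`; `νN` left-invariant on `N_Δ(𝔸)` and invariant under the
conjugations `u ↦ Λĝ u Λĝ⁻¹`, `g ∈ GL₂(L)` (BY VALUE); `β` an `N_Δ(L⁺)`-covering weight; `f` a continuous Siegel section of `I_Δ(s, χ)` satisfying the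
absolute-convergence hypothesis (H) at `h`; `Γ₀ = Stab([w₀])` with a covering weight `β₁`, `F(x) = ∫ β₁(u) • f(w₀ u x) dνN(u)` the INNER SECTION; `γ` a row
section `ℙ(L²) → GL₂(L)`.  THEN
  `HasSum (p ↦ F(Λ(γ p)^ · h)) (∫ β(u) • Σ_{q ∈ REST} f(γ_q u h) dνN(u))`
— the middle term of ★ `constTerm_three_cells` is `Σ_{B(L)∖GL₂(L)} F(Λ(γ)^ h)` (Fubini for series under (H); REST `= ⨆_p O(γ p)` (α2d-2); the orbit
values `tsum_orbit_reflStd_levi_eq`). [cite: MoeglinWaldspurger1995, II.1.7] [cite: KudlaRallis1994, §2] [cite: GelbartPiatetskishapiroRallis1987, Part A §2] -/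
theorem hasSum_middle_cell (hdV0 : ∀ i, dV i ≠ 0) (hdW0 : ∀ i, dW i ≠ 0) (νN : Measure (unipDelta L e dV hdV dW hdW)) [νN.IsMulLeftInvariant]
    {β : unipDelta L e dV hdV dW hdW → ℝ≥0∞} (hβ : IsCoveringWeight (unipDeltaRat L e dV hdV dW hdW) β)
    {χ : HeckeCharacter L} {s : ℂ} {f : HA L e dV hdV dW hdW → ℂ} (hf : IsSiegelDeltaSection L e dV hdV dW hdW χ s f) (hfc : Continuous f)
    (h : HA L e dV hdV dW hdW)
    (hH : ∫⁻ u, (∑' q : SiegelDeltaQuot L e dV hdV dW hdW,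
        ‖f ((((Quotient.out q : ratH L e dV hdV dW hdW) : HA L e dV hdV dW hdW)) * ((u : HA L e dV hdV dW hdW) * h))‖ₑ) * β u ∂νN ≠ ∞)
    {β₁ : unipDelta L e dV hdV dW hdW → ℝ≥0∞} (hβ₁ : IsCoveringWeight Γ₀ β₁)
    (hconj : ∀ g : GL (Fin 2) L, MeasurePreserving (fun u : unipDelta L e dV hdV dW hdW =>
      (⟨Λ (Matrix.GeneralLinearGroup.map (algebraMap L (AdeleRing (𝓞 L) L)) g) * (u : HA L e dV hdV dW hdW) *
          (Λ (Matrix.GeneralLinearGroup.map (algebraMap L (AdeleRing (𝓞 L) L)) g))⁻¹,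
        conj_levi_mem_unipDelta L e dV hdV dW hdW Λ hΛ _ u.2⟩ : unipDelta L e dV hdV dW hdW)) νN νN)
    (F : HA L e dV hdV dW hdW → ℂ)
    (hF : ∀ x, F x = ∫ u, (β₁ u).toReal •
      f (iotaGG L e dV hdV dW hdW (1, UnitaryGroup.rationalPairToAdelic (Fp L) L (IsCMField.complexConj L) N M (Matrix.diagonal dV) (Matrix.diagonal dW) g₀) *
        ((u : HA L e dV hdV dW hdW) * x)) ∂νN)
    (γ : Projectivization L (Fin 2 → L) → GL (Fin 2) L)
    (hγ : ∀ p, Projectivization.mk L ((γ p : Matrix (Fin 2) (Fin 2) L) 1) (row_ne_zero (γ p) 1) = p) :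
    HasSum (fun p : Projectivization L (Fin 2 → L) => F (Λ (Matrix.GeneralLinearGroup.map (algebraMap L (AdeleRing (𝓞 L) L)) (γ p)) * h))
      (∫ u, (β u).toReal • (∑' q : ↥(({Quotient.mk (MulAction.orbitRel (siegelDeltaRat L e dV hdV dW hdW) (ratH L e dV hdV dW hdW)) 1} ∪
            Set.range (fun ν : unipDeltaRat L e dV hdV dW hdW =>
              (Quotient.mk (MulAction.orbitRel (siegelDeltaRat L e dV hdV dW hdW) (ratH L e dV hdV dW hdW)) (wq ν) :
                SiegelDeltaQuot L e dV hdV dW hdW)))ᶜ : Set (SiegelDeltaQuot L e dV hdV dW hdW)),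
          f ((((Quotient.out (q : SiegelDeltaQuot L e dV hdV dW hdW) : ratH L e dV hdV dW hdW) : HA L e dV hdV dW hdW)) *
            ((u : HA L e dV hdV dW hdW) * h))) ∂νN) := by
  have hγ₀ : ∀ p : Projectivization L (Fin 2 → L),
      iotaGG L e dV hdV dW hdW (1, UnitaryGroup.rationalPairToAdelic (Fp L) L (IsCMField.complexConj L) N M (Matrix.diagonal dV) (Matrix.diagonal dW) g₀) *
        Λ (Matrix.GeneralLinearGroup.map (algebraMap L (AdeleRing (𝓞 L) L)) (γ p)) ∈ ratH L e dV hdV dW hdW := fun p =>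
    mul_mem (iotaGG_one_mem_ratH L e dV hdV dW hdW g₀) (levi_map_mem_ratH L e dV hdV dW hdW Λ hΛ hdV0 hdW0 (γ p))
  have hRO := rest_eq_iUnion_orbit wq hwq hg₀ Λ hΛ hdV0 hdW0 γ hγ hγ₀
  have hdisj : Pairwise (Disjoint on fun p : Projectivization L (Fin 2 → L) => Set.range (fun ν : unipDeltaRat L e dV hdV dW hdW =>
        (Quotient.mk (MulAction.orbitRel (siegelDeltaRat L e dV hdV dW hdW) (ratH L e dV hdV dW hdW))
          ((⟨_, hγ₀ p⟩ : ratH L e dV hdV dW hdW) * ⟨((ν : unipDelta L e dV hdV dW hdW) : HA L e dV hdV dW hdW), coe_mem_ratH ν⟩)))) :=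
    fun p p' hpp' => pairwise_disjoint_orbit hg₀ Λ hΛ γ hγ hγ₀ hpp'
  have hOp : ∀ p : Projectivization L (Fin 2 → L), ∫⁻ u, (∑' q : ↥(Set.range (fun ν : unipDeltaRat L e dV hdV dW hdW =>
        (Quotient.mk (MulAction.orbitRel (siegelDeltaRat L e dV hdV dW hdW) (ratH L e dV hdV dW hdW))
          ((⟨_, hγ₀ p⟩ : ratH L e dV hdV dW hdW) * ⟨((ν : unipDelta L e dV hdV dW hdW) : HA L e dV hdV dW hdW), coe_mem_ratH ν⟩)))),
        ‖f (((Quotient.out q.1 : ratH L e dV hdV dW hdW) : HA L e dV hdV dW hdW) * ((u : HA L e dV hdV dW hdW) * h))‖ₑ) * β u ∂νN ≠ ∞ := by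
    intro p
    refine ne_top_of_le_ne_top hH (lintegral_mono fun u => mul_le_mul' ?_ le_rfl)
    exact ENNReal.tsum_comp_le_tsum_of_injective Subtype.val_injective
      (fun q : SiegelDeltaQuot L e dV hdV dW hdW => ‖f ((((Quotient.out q : ratH L e dV hdV dW hdW) : HA L e dV hdV dW hdW)) * ((u : HA L e dV hdV dW hdW) * h))‖ₑ)
  have key := hasSum_tsum_subtype_of_eq_iUnion (summable_integral_wt_smul νN hβ hfc h hH) hRO hdisj
  rw [integral_wt_smul_tsum_subtype_eq_tsum νN hβ hfc h hH]
  have hfun : (fun p : Projectivization L (Fin 2 → L) => F (Λ (Matrix.GeneralLinearGroup.map (algebraMap L (AdeleRing (𝓞 L) L)) (γ p)) * h)) =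
      fun p : Projectivization L (Fin 2 → L) => ∑' q : ↥(Set.range (fun ν : unipDeltaRat L e dV hdV dW hdW =>
        (Quotient.mk (MulAction.orbitRel (siegelDeltaRat L e dV hdV dW hdW) (ratH L e dV hdV dW hdW))
          ((⟨_, hγ₀ p⟩ : ratH L e dV hdV dW hdW) * ⟨((ν : unipDelta L e dV hdV dW hdW) : HA L e dV hdV dW hdW), coe_mem_ratH ν⟩)))),
        ∫ u, (β u).toReal • f (((Quotient.out q.1 : ratH L e dV hdV dW hdW) : HA L e dV hdV dW hdW) * ((u : HA L e dV hdV dW hdW) * h)) ∂νN :=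
    funext fun p => (tsum_orbit_reflStd_levi_eq Λ hΛ Γ₀ hΓ₀ hdV0 hdW0 νN hβ hf hfc h hβ₁ (γ p) (hconj (γ p)) F hF (hγ₀ p) (hOp p)).symm
  rw [hfun]
  exact key

include hwq hg₀ hΛ hΓ₀ in
/-- **`MID(h) = Σ_{p ∈ ℙ¹(L)} F(Λ(γ p)^ · h)`** and the sum converges absolutely — the `tsum` ∕ `Summable` reading of `hasSum_middle_cell`.
[cite: MoeglinWaldspurger1995, II.1.7] [cite: KudlaRallis1994, §2] -/
theorem middle_cell_eq_tsum (hdV0 : ∀ i, dV i ≠ 0) (hdW0 : ∀ i, dW i ≠ 0) (νN : Measure (unipDelta L e dV hdV dW hdW)) [νN.IsMulLeftInvariant]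
    {β : unipDelta L e dV hdV dW hdW → ℝ≥0∞} (hβ : IsCoveringWeight (unipDeltaRat L e dV hdV dW hdW) β)
    {χ : HeckeCharacter L} {s : ℂ} {f : HA L e dV hdV dW hdW → ℂ} (hf : IsSiegelDeltaSection L e dV hdV dW hdW χ s f) (hfc : Continuous f)
    (h : HA L e dV hdV dW hdW)
    (hH : ∫⁻ u, (∑' q : SiegelDeltaQuot L e dV hdV dW hdW,
        ‖f ((((Quotient.out q : ratH L e dV hdV dW hdW) : HA L e dV hdV dW hdW)) * ((u : HA L e dV hdV dW hdW) * h))‖ₑ) * β u ∂νN ≠ ∞)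
    {β₁ : unipDelta L e dV hdV dW hdW → ℝ≥0∞} (hβ₁ : IsCoveringWeight Γ₀ β₁)
    (hconj : ∀ g : GL (Fin 2) L, MeasurePreserving (fun u : unipDelta L e dV hdV dW hdW =>
      (⟨Λ (Matrix.GeneralLinearGroup.map (algebraMap L (AdeleRing (𝓞 L) L)) g) * (u : HA L e dV hdV dW hdW) *
          (Λ (Matrix.GeneralLinearGroup.map (algebraMap L (AdeleRing (𝓞 L) L)) g))⁻¹,
        conj_levi_mem_unipDelta L e dV hdV dW hdW Λ hΛ _ u.2⟩ : unipDelta L e dV hdV dW hdW)) νN νN)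
    (F : HA L e dV hdV dW hdW → ℂ)
    (hF : ∀ x, F x = ∫ u, (β₁ u).toReal •
      f (iotaGG L e dV hdV dW hdW (1, UnitaryGroup.rationalPairToAdelic (Fp L) L (IsCMField.complexConj L) N M (Matrix.diagonal dV) (Matrix.diagonal dW) g₀) *
        ((u : HA L e dV hdV dW hdW) * x)) ∂νN)
    (γ : Projectivization L (Fin 2 → L) → GL (Fin 2) L)
    (hγ : ∀ p, Projectivization.mk L ((γ p : Matrix (Fin 2) (Fin 2) L) 1) (row_ne_zero (γ p) 1) = p) :
    ∫ u, (β u).toReal • (∑' q : ↥(({Quotient.mk (MulAction.orbitRel (siegelDeltaRat L e dV hdV dW hdW) (ratH L e dV hdV dW hdW)) 1} ∪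
            Set.range (fun ν : unipDeltaRat L e dV hdV dW hdW =>
              (Quotient.mk (MulAction.orbitRel (siegelDeltaRat L e dV hdV dW hdW) (ratH L e dV hdV dW hdW)) (wq ν) :
                SiegelDeltaQuot L e dV hdV dW hdW)))ᶜ : Set (SiegelDeltaQuot L e dV hdV dW hdW)),
          f ((((Quotient.out (q : SiegelDeltaQuot L e dV hdV dW hdW) : ratH L e dV hdV dW hdW) : HA L e dV hdV dW hdW)) *
            ((u : HA L e dV hdV dW hdW) * h))) ∂νN =
      ∑' p : Projectivization L (Fin 2 → L), F (Λ (Matrix.GeneralLinearGroup.map (algebraMap L (AdeleRing (𝓞 L) L)) (γ p)) * h) ∧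
    Summable (fun p : Projectivization L (Fin 2 → L) => F (Λ (Matrix.GeneralLinearGroup.map (algebraMap L (AdeleRing (𝓞 L) L)) (γ p)) * h)) :=
  ⟨(hasSum_middle_cell hg₀ Λ hΛ Γ₀ hΓ₀ wq hwq hdV0 hdW0 νN hβ hf hfc h hH hβ₁ hconj F hF γ hγ).tsum_eq.symm,
    (hasSum_middle_cell hg₀ Λ hΛ Γ₀ hΓ₀ wq hwq hdV0 hdW0 νN hβ hf hfc h hH hβ₁ hconj F hF γ hγ).summable⟩

end Two

end Summit.HodgeConjecture.HodgeConjecture.Cruxes.HLiu418.K2LiuConstantTermMiddleCellGL2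

end
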